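import Summits.HodgeConjecture.CorCM.Census.SexticOcticWeilPartsBalanced
import HarnessLib

/-!
# `E × T × B` over a sextic and an octic CM field sharing `k`: EXTRACTION of a part from every non-empty balanced configuration, and
# the INDUCTION PRINCIPLE for balanced configurations (any number of copies)

COR-CM (cell `pub-hodgecm2`), seat b30 gen 26 (2026-08-23); count-neutral own lane SEXTIC-OCTIC, sequel of
`Census/SexticOcticWeil{,Defect,Parts,PartsBalanced}.lean`.  Theorems of the finite model only; no definition, no named fact, no
geometry, no `sorry`, no `decide`.

EXTRACTION (greedy, from the defect law `d₁ ≡ t₁`, `d₂ ≡ t₂`, `e = t₁ + 2t₂` under a JOINTLY TRANSITIVE realised set `R`):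
* `t₁ > 0 > t₂`: if `e < 0` an EIGHT part (`τ̄`, `T⁺`, `B⁻`), else `t₁ = e − 2t₂ ≥ 2` and a TEN part (`T⁺T⁺B⁻`); symmetrically for
  `t₁ < 0 < t₂`;
* otherwise all non-zero defects share a sign: `t₁ ≠ 0` gives a FOUR part (`|e| ≥ 1`), else `t₂ ≠ 0` a SIX part (`|e| = 2|t₂| ≥ 2`),
  else every count is conjugation-invariant and a non-empty configuration has a PAIR part.
Hence **`modelBalancedS_induction`**: a property of configurations that holds for `∅` and passes from `S` to `G ∪ S` for a disjoint
pair / four / six / eight / ten part `G` holds for every `R`-balanced configuration.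
[cite: Milne2020HodgeClassesAV, 1.2 (a) and Thm. 1] [cite: MoonenZarhin1995Duke, Thm. 2.4] [cite: GaoUllmo2025, Thm 3.1]

## References
* [Milne2020HodgeClassesAV] J. S. Milne, arXiv:2010.08857, 1.2 (a), Thm. 1.  [MoonenZarhin1995Duke] B. Moonen, Yu. Zarhin, Duke
  Math. J. 77 (1995), Thm. 2.4.  [GaoUllmo2025] Z. Gao, E. Ullmo, J. Inst. Math. Jussieu 25 (2025), Thm 3.1.
-/

namespace Summit.HodgeConjecture.CorCM.Census.SexticOcticWeil

open Finset

variable {α : Type*} {R : Finset (Equiv.Perm (Fin 3) × Equiv.Perm (Fin 4))} {v : α → PtS}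

/-! ### Membership and non-emptiness of the composite parts -/

/-- Every point of a four part lies over `inl b` or over a label `(1, a, b)`. [folklore] -/
theorem IsFourPartS.mem_cases [DecidableEq α] {b : Bool} {G : Finset α} (hG : IsFourPartS v b G) {x : α} (hx : x ∈ G) :
    v x = Sum.inl b ∨ ∃ a : Fin 3, v x = Sum.inr (Sum.inl (a, b)) := by
  obtain ⟨x₀, G₁, -, rfl, hvx₀, hG₁⟩ := hG.exists_split
  rcases Finset.mem_insert.1 hx with rfl | hx
  · exact Or.inl hvx₀
  · exact Or.inr (hG₁.exists_eq hx)

/-- Every point of a six part lies over `inl b` or over a label `(2, a, b)`. [folklore] -/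
theorem IsSixPartS.mem_cases [DecidableEq α] {b : Bool} {G : Finset α} (hG : IsSixPartS v b G) {x : α} (hx : x ∈ G) :
    v x = Sum.inl b ∨ ∃ a : Fin 4, v x = Sum.inr (Sum.inr (a, b)) := by
  obtain ⟨C, G₁, -, rfl, -, hvC, hG₁⟩ := hG.exists_split
  rcases Finset.mem_union.1 hx with hx | hx
  · exact Or.inl (hvC x hx)
  · exact Or.inr (hG₁.exists_eq hx)

/-- Every point of an eight part lies over `inl ¬b`, over a label `(1, a, b)` or over a label `(2, a, ¬b)`. [folklore] -/
theorem IsEightPartS.mem_cases [DecidableEq α] {b : Bool} {G : Finset α} (hG : IsEightPartS v b G) {x : α} (hx : x ∈ G) :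
    v x = Sum.inl (!b) ∨ (∃ a : Fin 3, v x = Sum.inr (Sum.inl (a, b))) ∨ ∃ a : Fin 4, v x = Sum.inr (Sum.inr (a, !b)) := by
  obtain ⟨x₀, G₁, G₂, -, -, -, rfl, hvx₀, hG₁, hG₂⟩ := hG.exists_split
  rcases Finset.mem_insert.1 hx with rfl | hx
  · exact Or.inl hvx₀
  · rcases Finset.mem_union.1 hx with hx | hx
    · exact Or.inr (Or.inl (hG₁.exists_eq hx))
    · exact Or.inr (Or.inr (hG₂.exists_eq hx))

/-- Every point of a ten part lies over a label `(1, a, b)` or over a label `(2, a, ¬b)`. [folklore] -/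
theorem IsTenPartS.mem_cases [DecidableEq α] {b : Bool} {G : Finset α} (hG : IsTenPartS v b G) {x : α} (hx : x ∈ G) :
    (∃ a : Fin 3, v x = Sum.inr (Sum.inl (a, b))) ∨ ∃ a : Fin 4, v x = Sum.inr (Sum.inr (a, !b)) := by
  obtain ⟨G₀, G₁, G₂, -, -, -, rfl, hG₀, hG₁, hG₂⟩ := hG.exists_split
  rcases Finset.mem_union.1 hx with hx | hx
  · rcases Finset.mem_union.1 hx with hx | hx
    · exact Or.inl (hG₀.exists_eq hx)
    · exact Or.inl (hG₁.exists_eq hx)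
  · exact Or.inr (hG₂.exists_eq hx)

/-- A four part is non-empty. [folklore] -/
theorem IsFourPartS.nonempty {b : Bool} {G : Finset α} (hG : IsFourPartS v b G) : G.Nonempty := by
  rw [← Finset.card_pos, hG.1]; norm_num

/-- A six part is non-empty. [folklore] -/
theorem IsSixPartS.nonempty {b : Bool} {G : Finset α} (hG : IsSixPartS v b G) : G.Nonempty := by
  rw [← Finset.card_pos, hG.1]; norm_num

/-- An eight part is non-empty. [folklore] -/
theorem IsEightPartS.nonempty {b : Bool} {G : Finset α} (hG : IsEightPartS v b G) : G.Nonempty := by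
  rw [← Finset.card_pos, hG.1]; norm_num

/-- A ten part is non-empty. [folklore] -/
theorem IsTenPartS.nonempty {b : Bool} {G : Finset α} (hG : IsTenPartS v b G) : G.Nonempty := by
  rw [← Finset.card_pos, hG.1]; norm_num

/-! ### The composite parts from the counts -/

/-- Filters of a union with a three part over labels off the three part. [folklore] -/
private theorem card_filter_union_three [DecidableEq α] {b : Bool} {W S : Finset α} (hW : IsThreePartS v b W) {z : PtS} (hz : ∀ a : Fin 3, z ≠ Sum.inr (Sum.inl (a, b))) :
    ((S ∪ W).filter fun x => v x = z).card = (S.filter fun x => v x = z).card := by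
  rw [Finset.filter_union, Finset.filter_false_of_mem (s := W) fun x hx h => ?_, Finset.union_empty]
  obtain ⟨a, ha⟩ := hW.exists_eq hx
  exact hz a (h.symm.trans ha)

/-- Filters of a union with a quad part over labels off the quad part. [folklore] -/
private theorem card_filter_union_quad [DecidableEq α] {b : Bool} {W S : Finset α} (hW : IsQuadPartS v b W) {z : PtS} (hz : ∀ a : Fin 4, z ≠ Sum.inr (Sum.inr (a, b))) :
    ((S ∪ W).filter fun x => v x = z).card = (S.filter fun x => v x = z).card := by
  rw [Finset.filter_union, Finset.filter_false_of_mem (s := W) fun x hx h => ?_, Finset.union_empty]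
  obtain ⟨a, ha⟩ := hW.exists_eq hx
  exact hz a (h.symm.trans ha)

/-- `n` points of `T` over the label `y`, given `n ≤ N(y)`. [folklore] -/
private theorem exists_fibre_subset [DecidableEq α] {T : Finset α} (y : PtS) {n : ℕ} (hn : n ≤ (T.filter fun x => v x = y).card) :
    ∃ C ⊆ T, C.card = n ∧ ∀ x ∈ C, v x = y := by
  obtain ⟨C, hC, hcard⟩ := Finset.exists_subset_card_eq hn
  exact ⟨C, fun x hx => (Finset.mem_filter.1 (hC hx)).1, hcard, fun x hx => (Finset.mem_filter.1 (hC hx)).2⟩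

/-- A four part inside `T` from the counts. [folklore] -/
theorem exists_fourPartS_of_counts [DecidableEq α] {T : Finset α} (b : Bool) (hE : 0 < (T.filter fun x => v x = Sum.inl b).card)
    (hT : ∀ a : Fin 3, 0 < (T.filter fun x => v x = Sum.inr (Sum.inl (a, b))).card) : ∃ G ⊆ T, IsFourPartS v b G := by
  obtain ⟨C, hCT, hC, hvC⟩ := exists_fibre_subset (v := v) (Sum.inl b) (Nat.one_le_of_lt hE)
  obtain ⟨W, hWT, hW⟩ := exists_threePartS_of_counts (v := v) (T := T) b hT
  have hCW : Disjoint C W := by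
    rw [Finset.disjoint_left]
    intro x hxC hxW
    obtain ⟨a, ha⟩ := hW.exists_eq hxW
    rw [hvC x hxC] at ha; exact Sum.inl_ne_inr ha
  refine ⟨C ∪ W, Finset.union_subset hCT hWT, ?_, ?_, fun a => ?_⟩
  · rw [Finset.card_union_of_disjoint hCW, hC, hW.1]
  · rw [card_filter_union_three (S := C) hW fun a => Sum.inl_ne_inr, Finset.filter_true_of_mem hvC, hC]
  · rw [Finset.filter_union, Finset.filter_false_of_mem (s := C) fun x hx h => ?_, Finset.empty_union, hW.2 a]
    rw [hvC x hx] at h; exact Sum.inl_ne_inr h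

/-- A six part inside `T` from the counts (two curve points over `τ_b`). [folklore] -/
theorem exists_sixPartS_of_counts [DecidableEq α] {T : Finset α} (b : Bool) (hE : 2 ≤ (T.filter fun x => v x = Sum.inl b).card)
    (hB : ∀ a : Fin 4, 0 < (T.filter fun x => v x = Sum.inr (Sum.inr (a, b))).card) : ∃ G ⊆ T, IsSixPartS v b G := by
  obtain ⟨C, hCT, hC, hvC⟩ := exists_fibre_subset (v := v) (Sum.inl b) hE
  obtain ⟨W, hWT, hW⟩ := exists_quadPartS_of_counts (v := v) (T := T) b hB
  have hCW : Disjoint C W := by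
    rw [Finset.disjoint_left]
    intro x hxC hxW
    obtain ⟨a, ha⟩ := hW.exists_eq hxW
    rw [hvC x hxC] at ha; exact Sum.inl_ne_inr ha
  refine ⟨C ∪ W, Finset.union_subset hCT hWT, ?_, ?_, fun a => ?_⟩
  · rw [Finset.card_union_of_disjoint hCW, hC, hW.1]
  · rw [card_filter_union_quad (S := C) hW fun a => Sum.inl_ne_inr, Finset.filter_true_of_mem hvC, hC]
  · rw [Finset.filter_union, Finset.filter_false_of_mem (s := C) fun x hx h => ?_, Finset.empty_union, hW.2 a]
    rw [hvC x hx] at h; exact Sum.inl_ne_inr h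

/-- An eight part inside `T` from the counts. [folklore] -/
theorem exists_eightPartS_of_counts [DecidableEq α] {T : Finset α} (b : Bool)
    (hE : 0 < (T.filter fun x => v x = Sum.inl (!b)).card)
    (hT : ∀ a : Fin 3, 0 < (T.filter fun x => v x = Sum.inr (Sum.inl (a, b))).card)
    (hB : ∀ a : Fin 4, 0 < (T.filter fun x => v x = Sum.inr (Sum.inr (a, !b))).card) : ∃ G ⊆ T, IsEightPartS v b G := by
  obtain ⟨C, hCT, hC, hvC⟩ := exists_fibre_subset (v := v) (Sum.inl (!b)) (Nat.one_le_of_lt hE)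
  obtain ⟨W₁, hW₁T, hW₁⟩ := exists_threePartS_of_counts (v := v) (T := T) b hT
  obtain ⟨W₂, hW₂T, hW₂⟩ := exists_quadPartS_of_counts (v := v) (T := T) (!b) hB
  have hCW₁ : Disjoint C W₁ := by
    rw [Finset.disjoint_left]
    intro x hxC hxW
    obtain ⟨a, ha⟩ := hW₁.exists_eq hxW
    rw [hvC x hxC] at ha; exact Sum.inl_ne_inr ha
  have hW₁₂ : Disjoint W₁ W₂ := by
    rw [Finset.disjoint_left]
    intro x hx1 hx2
    obtain ⟨a, ha⟩ := hW₁.exists_eq hx1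
    obtain ⟨a', ha'⟩ := hW₂.exists_eq hx2
    have := ha.symm.trans ha'
    simp at this
  have hCW₂ : Disjoint (C ∪ W₁) W₂ := by
    rw [Finset.disjoint_union_left]
    refine ⟨Finset.disjoint_left.2 fun x hxC hxW => ?_, hW₁₂⟩
    obtain ⟨a, ha⟩ := hW₂.exists_eq hxW
    rw [hvC x hxC] at ha; exact Sum.inl_ne_inr ha
  refine ⟨C ∪ W₁ ∪ W₂, Finset.union_subset (Finset.union_subset hCT hW₁T) hW₂T, ?_, ?_, fun a => ?_, fun a => ?_⟩
  · rw [Finset.card_union_of_disjoint hCW₂, Finset.card_union_of_disjoint hCW₁, hC, hW₁.1, hW₂.1]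
  · rw [card_filter_union_quad (S := C ∪ W₁) hW₂ fun a => Sum.inl_ne_inr,
      card_filter_union_three (S := C) hW₁ fun a => Sum.inl_ne_inr, Finset.filter_true_of_mem hvC, hC]
  · have hq := card_filter_union_quad (S := C ∪ W₁) hW₂ (z := Sum.inr (Sum.inl (a, b))) fun a' h => by simp at h
    rw [hq, Finset.filter_union, Finset.filter_false_of_mem (s := C) fun x hx h => ?_, Finset.empty_union, hW₁.2 a]
    rw [hvC x hx] at h; exact Sum.inl_ne_inr h
  · rw [Finset.filter_union, Finset.filter_false_of_mem (s := C ∪ W₁) fun x hx h => ?_, Finset.empty_union, hW₂.2 a]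
    rcases Finset.mem_union.1 hx with hx | hx
    · rw [hvC x hx] at h; exact Sum.inl_ne_inr h
    · obtain ⟨a', ha'⟩ := hW₁.exists_eq hx
      have := h.symm.trans ha'
      simp at this

/-- A ten part inside `T` from the counts (two points over each `(1, a, b)`). [folklore] -/
theorem exists_tenPartS_of_counts [DecidableEq α] {T : Finset α} (b : Bool)
    (hT : ∀ a : Fin 3, 2 ≤ (T.filter fun x => v x = Sum.inr (Sum.inl (a, b))).card)
    (hB : ∀ a : Fin 4, 0 < (T.filter fun x => v x = Sum.inr (Sum.inr (a, !b))).card) : ∃ G ⊆ T, IsTenPartS v b G := by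
  obtain ⟨W₀, hW₀T, hW₀⟩ := exists_threePartS_of_counts (v := v) (T := T) b fun a => by have h := hT a; omega
  have hrest : ∀ a : Fin 3, 0 < ((T \ W₀).filter fun x => v x = Sum.inr (Sum.inl (a, b))).card := by
    intro a
    have h1 : ((T \ W₀).filter fun x => v x = Sum.inr (Sum.inl (a, b))).card =
        (T.filter fun x => v x = Sum.inr (Sum.inl (a, b))).card - (W₀.filter fun x => v x = Sum.inr (Sum.inl (a, b))).card := by
      rw [← Finset.card_sdiff_of_subset (Finset.filter_subset_filter _ hW₀T)]
      congr 1
      ext x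
      simp only [Finset.mem_filter, Finset.mem_sdiff]
      tauto
    rw [h1, hW₀.2 a]
    have h := hT a; omega
  obtain ⟨W₁, hW₁T', hW₁⟩ := exists_threePartS_of_counts (v := v) (T := T \ W₀) b hrest
  have hW₁T : W₁ ⊆ T := fun z hz => (Finset.mem_sdiff.1 (hW₁T' hz)).1
  obtain ⟨W₂, hW₂T, hW₂⟩ := exists_quadPartS_of_counts (v := v) (T := T) (!b) hB
  have h01 : Disjoint W₀ W₁ := Finset.disjoint_left.2 fun z hz0 hz1 => (Finset.mem_sdiff.1 (hW₁T' hz1)).2 hz0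
  have h3q : ∀ {W : Finset α}, IsThreePartS v b W → Disjoint W W₂ := fun hW => by
    rw [Finset.disjoint_left]
    intro x hx1 hx2
    obtain ⟨a, ha⟩ := hW.exists_eq hx1
    obtain ⟨a', ha'⟩ := hW₂.exists_eq hx2
    have := ha.symm.trans ha'
    simp at this
  have h012 : Disjoint (W₀ ∪ W₁) W₂ := Finset.disjoint_union_left.2 ⟨h3q hW₀, h3q hW₁⟩
  refine ⟨W₀ ∪ W₁ ∪ W₂, Finset.union_subset (Finset.union_subset hW₀T hW₁T) hW₂T, ?_, fun a => ?_, fun a => ?_⟩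
  · rw [Finset.card_union_of_disjoint h012, Finset.card_union_of_disjoint h01, hW₀.1, hW₁.1, hW₂.1]
  · have hq := card_filter_union_quad (S := W₀ ∪ W₁) hW₂ (z := Sum.inr (Sum.inl (a, b))) fun a' h => by simp at h
    rw [hq, Finset.filter_union, Finset.card_union_of_disjoint (Finset.disjoint_filter_filter h01), hW₀.2 a, hW₁.2 a]
  · rw [Finset.filter_union, Finset.filter_false_of_mem (s := W₀ ∪ W₁) fun x hx h => ?_, Finset.empty_union, hW₂.2 a]
    rcases Finset.mem_union.1 hx with hx | hx
    · obtain ⟨a', ha'⟩ := hW₀.exists_eq hx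
      have := h.symm.trans ha'
      simp at this
    · obtain ⟨a', ha'⟩ := hW₁.exists_eq hx
      have := h.symm.trans ha'
      simp at this

/-! ### Extraction and induction -/

section Extraction

variable (hjt : JointTransitive R)

include hjt in
/-- **EXTRACTION.**  Under a jointly transitive `R`, a non-empty `R`-balanced configuration contains a pair, four, six, eight or ten part
(module docstring: greedy on the signs of the defects `t₁`, `t₂` and of `e = t₁ + 2t₂`).
[cite: Milne2020HodgeClassesAV, 1.2 (a) and Thm. 1] [cite: MoonenZarhin1995Duke, Thm. 2.4] -/
theorem exists_part_of_modelBalancedS [DecidableEq α] {T : Finset α} (hT : ModelBalancedS R v T) (hne : T.Nonempty) :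
    ∃ G ⊆ T, IsPairPartS v G ∨ (∃ b, IsFourPartS v b G) ∨ (∃ b, IsSixPartS v b G) ∨ (∃ b, IsEightPartS v b G) ∨
      ∃ b, IsTenPartS v b G := by
  obtain ⟨t₁, t₂, h₁, h₂, hE⟩ := exists_defectS_of_modelBalancedS hjt hT
  -- opposite strict signs, `t₁ > 0 > t₂`
  by_cases hA : 0 < t₁ ∧ t₂ < 0
  · obtain ⟨ht₁, ht₂⟩ := hA
    by_cases he : t₁ + 2 * t₂ < 0
    · obtain ⟨G, hG, h⟩ := exists_eightPartS_of_counts (v := v) (T := T) true (by rw [Bool.not_true]; omega)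
        (fun a => by have h := h₁ a; omega) (fun a => by have h := h₂ a; rw [Bool.not_true]; omega)
      exact ⟨G, hG, Or.inr (Or.inr (Or.inr (Or.inl ⟨true, h⟩)))⟩
    · obtain ⟨G, hG, h⟩ := exists_tenPartS_of_counts (v := v) (T := T) true
        (fun a => by have h := h₁ a; omega) (fun a => by have h := h₂ a; rw [Bool.not_true]; omega)
      exact ⟨G, hG, Or.inr (Or.inr (Or.inr (Or.inr ⟨true, h⟩)))⟩
  -- opposite strict signs, `t₁ < 0 < t₂`
  by_cases hB : t₁ < 0 ∧ 0 < t₂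
  · obtain ⟨ht₁, ht₂⟩ := hB
    by_cases he : 0 < t₁ + 2 * t₂
    · obtain ⟨G, hG, h⟩ := exists_eightPartS_of_counts (v := v) (T := T) false (by rw [Bool.not_false]; omega)
        (fun a => by have h := h₁ a; omega) (fun a => by have h := h₂ a; rw [Bool.not_false]; omega)
      exact ⟨G, hG, Or.inr (Or.inr (Or.inr (Or.inl ⟨false, h⟩)))⟩
    · obtain ⟨G, hG, h⟩ := exists_tenPartS_of_counts (v := v) (T := T) false
        (fun a => by have h := h₁ a; omega) (fun a => by have h := h₂ a; rw [Bool.not_false]; omega)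
      exact ⟨G, hG, Or.inr (Or.inr (Or.inr (Or.inr ⟨false, h⟩)))⟩
  -- a four part
  by_cases h1p : 0 < t₁
  · have ht₂ : 0 ≤ t₂ := by by_contra h; exact hA ⟨h1p, by omega⟩
    obtain ⟨G, hG, h⟩ := exists_fourPartS_of_counts (v := v) (T := T) true (by omega) fun a => by have h := h₁ a; omega
    exact ⟨G, hG, Or.inr (Or.inl ⟨true, h⟩)⟩
  by_cases h1n : t₁ < 0
  · have ht₂ : t₂ ≤ 0 := by by_contra h; exact hB ⟨h1n, by omega⟩
    obtain ⟨G, hG, h⟩ := exists_fourPartS_of_counts (v := v) (T := T) false (by omega) fun a => by have h := h₁ a; omega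
    exact ⟨G, hG, Or.inr (Or.inl ⟨false, h⟩)⟩
  have ht₁ : t₁ = 0 := by omega
  -- a six part
  by_cases h2p : 0 < t₂
  · obtain ⟨G, hG, h⟩ := exists_sixPartS_of_counts (v := v) (T := T) true (by omega) fun a => by have h := h₂ a; omega
    exact ⟨G, hG, Or.inr (Or.inr (Or.inl ⟨true, h⟩))⟩
  by_cases h2n : t₂ < 0
  · obtain ⟨G, hG, h⟩ := exists_sixPartS_of_counts (v := v) (T := T) false (by omega) fun a => by have h := h₂ a; omega
    exact ⟨G, hG, Or.inr (Or.inr (Or.inl ⟨false, h⟩))⟩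
  have ht₂ : t₂ = 0 := by omega
  -- all defects vanish: conjugation-invariant counts, a pair part
  subst ht₁ ht₂
  obtain ⟨x, hx⟩ := hne
  have hNx : 0 < (T.filter fun x' => v x' = v x).card := Finset.card_pos.2 ⟨x, Finset.mem_filter.2 ⟨hx, rfl⟩⟩
  have hNcx : 0 < (T.filter fun x' => v x' = cjS (v x)).card := by
    rcases hvx : v x with s | ⟨⟨a, s⟩ | ⟨a, s⟩⟩ <;> rw [hvx] at hNx
    · cases s
      · rw [cjS_inl, Bool.not_false]; omega
      · rw [cjS_inl, Bool.not_true]; omega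
    · have h := h₁ a
      cases s
      · rw [cjS_inr_inl, Bool.not_false]; omega
      · rw [cjS_inr_inl, Bool.not_true]; omega
    · have h := h₂ a
      cases s
      · rw [cjS_inr_inr, Bool.not_false]; omega
      · rw [cjS_inr_inr, Bool.not_true]; omega
  obtain ⟨G, hG, hP'⟩ := exists_pairPartS_of_counts (y := v x) hNx hNcx
  exact ⟨G, hG, Or.inl hP'⟩

include hjt in
/-- **INDUCTION PRINCIPLE FOR BALANCED CONFIGURATIONS (any number of copies of `E, T, B`).**  If `motive` holds for `∅` and passes from
`S` to `G ∪ S` for `G` disjoint from `S` a pair, four, six, eight or ten part, then `motive` holds for every `R`-balanced configuration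
(`R` jointly transitive). [cite: Milne2020HodgeClassesAV, 1.2 (a) and Thm. 1] [cite: GaoUllmo2025, Thm 3.1] -/
theorem modelBalancedS_induction [DecidableEq α] {motive : Finset α → Prop} (h0 : motive ∅)
    (hpair : ∀ G S : Finset α, Disjoint G S → IsPairPartS v G → motive S → motive (G ∪ S))
    (hfour : ∀ (G S : Finset α) (b : Bool), Disjoint G S → IsFourPartS v b G → motive S → motive (G ∪ S))
    (hsix : ∀ (G S : Finset α) (b : Bool), Disjoint G S → IsSixPartS v b G → motive S → motive (G ∪ S))
    (height : ∀ (G S : Finset α) (b : Bool), Disjoint G S → IsEightPartS v b G → motive S → motive (G ∪ S))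
    (hten : ∀ (G S : Finset α) (b : Bool), Disjoint G S → IsTenPartS v b G → motive S → motive (G ∪ S))
    {T : Finset α} (hT : ModelBalancedS R v T) : motive T := by
  induction T using Finset.strongInduction with
  | H T ih =>
    by_cases hTe : T = ∅
    · subst hTe; exact h0
    obtain ⟨G, hGT, hG⟩ := exists_part_of_modelBalancedS hjt hT (Finset.nonempty_iff_ne_empty.2 hTe)
    have step : ModelBalancedS R v G → G.Nonempty → (∀ S, Disjoint G S → motive S → motive (G ∪ S)) → motive T := by
      intro hGb hGne hstep
      have hR : ModelBalancedS R v (T \ G) := hT.sdiff hGb hGT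
      have hlt : T \ G ⊂ T := Finset.sdiff_ssubset hGT hGne
      have h := hstep (T \ G) Finset.disjoint_sdiff (ih _ hlt hR)
      rwa [Finset.union_sdiff_of_subset hGT] at h
    rcases hG with hP | ⟨b, h4⟩ | ⟨b, h6⟩ | ⟨b, h8⟩ | ⟨b, h10⟩
    · exact step (fun π _ => hP.balancedS π) hP.nonempty fun S hd hm => hpair G S hd hP hm
    · exact step (fun π _ => h4.balancedS π) h4.nonempty fun S hd hm => hfour G S b hd h4 hm
    · exact step (fun π _ => h6.balancedS π) h6.nonempty fun S hd hm => hsix G S b hd h6 hm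
    · exact step (fun π _ => h8.balancedS π) h8.nonempty fun S hd hm => height G S b hd h8 hm
    · exact step (fun π _ => h10.balancedS π) h10.nonempty fun S hd hm => hten G S b hd h10 hm

end Extraction

end Summit.HodgeConjecture.CorCM.Census.SexticOcticWeil
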